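import Mathlib.RepresentationTheory.Irreducible
import Mathlib.LinearAlgebra.FiniteDimensional.Lemmas
import Summits.Langlands.Langlands.Theorems.IrreducibilityBySelfDualityReciprocityUpToIrreducibilityRStringBasics
import Summits.Langlands.Langlands.Theorems.IrreducibilityBySelfDualityReciprocityUpToIrreducibilityRTwistSchur
import Summits.Langlands.Langlands.Theorems.IrreducibilityBySelfDualityReciprocityUpToIrreducibilityRModelHom
import HarnessLib

/-!
# The `Hom`-count against a single string (toward stub S-17a-B of line `Sketch`,
# crux stmt-Langlands-17925 `IrreducibilityBySelfDuality.ReciprocityUpToIrreducibilityR`)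

Henniart 2002 (Bull. SMF 130), Thm 1.7 (a), §4: for a string `S' = H' + N H' + ⋯ + N^{e-1} H'`
(`IsStringHead σ H' e`) of a Weil–Deligne representation `σ` and an irreducible representation `ρ` of
`W_F` on `H`, the head space `Hom_W(ρ, σ; N^d = 0, S')` (`headSpace ρ σ d S'`: `W_F`-equivariant
`g : H → V` with `N^d ∘ g = 0` and values in `S'`; = `Hom_WD(ρ ⊗ Sp(d), σ|_{S'})` by restriction to the
head) has dimension `1` if `ρ ≅ ρ_{H'} ⊗ ‖·‖^i` for some `i < e` with `e ≤ d + i`, and `0` otherwise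
(registered sub-goal `stub_finrank_headSpace_stringSpan`).  Proof: the DEPTH `m` of a non-zero `g` (least
`m` with `N^m ∘ g = 0`) satisfies `N^{m-1} ∘ g : ρ ⊗ ‖·‖^{m-1} ⥲ socle N^{e-1} H' ≅ ρ_{H'} ⊗ ‖·‖^{e-1}`,
so `ρ ≅ ρ_{H'} ⊗ ‖·‖^{e-m}`; uniqueness of the twist pins `m`, and Schur on the socle bounds the dimension
by `1`; the map `N^i|_{H'} ∘ (ρ ≅ ρ_{H'} ⊗ ‖·‖^i)⁻¹` realises it.  No definitions; standard axioms only.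
-/

noncomputable section

set_option linter.dupNamespace false

open Module
open Literature.NumberTheory.Automorphic Literature.NumberTheory.GaloisRepresentations
open Literature.NumberTheory.GaloisRepresentations.WeilGroup
open Literature.NumberTheory.GaloisRepresentations.IsNonarchimedeanLocalField

namespace Summit.Langlands.Langlands.Theorems.ReciprocityUpToIrreducibilityR

variable {F : Type} [Field F] [ValuativeRel F] [TopologicalSpace F] [IsNonarchimedeanLocalField F]
variable {V : Type*} [AddCommGroup V] [Module ℂ V] {H : Type*} [AddCommGroup H] [Module ℂ H]

/-! ## Pieces of a string: socle, irreducibility, twisted isomorphisms -/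

section Pieces

variable {σ : WeilDeligneRep F ℂ V} {H' : Submodule ℂ V} {e : ℕ}

/-- A string is killed by `N^e`. [cite: TateCorvallis1979, (4.1.5)] -/
theorem stringSpan_le_ker (h : IsStringHead σ H' e) : stringSpan σ H' e ≤ LinearMap.ker (σ.N ^ e) := by
  intro x hx
  obtain ⟨y, hy, rfl⟩ := (mem_stringSpan_iff σ).mp hx
  rw [LinearMap.mem_ker, pow_N_strMap]
  have : (fun j : Fin e => (σ.N ^ e) (y j)) = 0 := funext fun j => LinearMap.mem_ker.mp (h.le_ker (hy j))
  rw [this, map_zero]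

/-- Powers of `N` preserve a string. [cite: TateCorvallis1979, (4.1.5)] -/
theorem pow_N_mem_stringSpan (h : IsStringHead σ H' e) (k : ℕ) {x : V} (hx : x ∈ stringSpan σ H' e) :
    (σ.N ^ k) x ∈ stringSpan σ H' e := by
  induction k with
  | zero => simpa using hx
  | succ k ih => rw [pow_succ', Module.End.mul_apply]; exact (isSubrep_stringSpan h.irreducible.2.1 h.le_ker).2 ih

/-- `N^i y` lies in the string for `y ∈ H'`, `i < e`. [cite: TateCorvallis1979, (4.1.5)] -/
theorem pow_N_apply_mem_stringSpan {i : ℕ} (hi : i < e) {y : V} (hy : y ∈ H') :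
    (σ.N ^ i) y ∈ stringSpan σ H' e := by
  classical
  refine (mem_stringSpan_iff σ).mpr ⟨Pi.single (⟨i, hi⟩ : Fin e) y, fun j => ?_, ?_⟩
  · by_cases hj : j = ⟨i, hi⟩
    · subst hj; simpa using hy
    · simp [hj]
  · rw [strMap_apply, Finset.sum_eq_single (⟨i, hi⟩ : Fin e) (fun j _ hj => by simp [hj]) (by simp)]
    simp

/-- **The socle of a string**: an element of the string killed by `N` lies in the last piece
`N^{e-1} H'` (independence of the pieces). [cite: TateCorvallis1979, (4.1.5)] -/
theorem mem_socle_of_mem_stringSpan (h : IsStringHead σ H' e) {x : V} (hx : x ∈ stringSpan σ H' e)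
    (hx0 : σ.N x = 0) : x ∈ H'.map (σ.N ^ (e - 1)) := by
  obtain ⟨y, hy, rfl⟩ := (mem_stringSpan_iff σ).mp hx
  obtain ⟨e', rfl⟩ : ∃ e', e = e' + 1 := ⟨e - 1, by have := h.pos; omega⟩
  have hlast : (σ.N ^ (e' + 1)) (y (Fin.last e')) = 0 := LinearMap.mem_ker.mp (h.le_ker (hy _))
  rw [N_strMap_succ σ e' y hlast] at hx0
  have hz := strMap_eq_zero_imp σ (e' + 1) H' h.le_ker h.disjoint_ker
    (Fin.cons 0 (fun j : Fin e' => y j.castSucc)) (fun j => by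
      refine Fin.cases ?_ (fun i => ?_) j
      · simp
      · simpa using hy i.castSucc) hx0
  have hy0 : ∀ j : Fin e', y j.castSucc = 0 := fun j => by
    have := congr_fun hz j.succ
    simpa using this
  rw [strMap_apply, Fin.sum_univ_castSucc, Finset.sum_eq_zero (fun j _ => by rw [hy0 j, map_zero]),
    zero_add, Nat.add_sub_cancel, Fin.val_last]
  exact Submodule.mem_map_of_mem (hy _)

/-- `N^k` is injective on the head for `k ≤ e - 1`. [cite: TateCorvallis1979, (4.1.5)] -/
theorem disjoint_head_ker (h : IsStringHead σ H' e) {k : ℕ} (hk : k ≤ e - 1) :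
    Disjoint H' (LinearMap.ker (σ.N ^ k)) :=
  h.disjoint_ker.mono_right (ker_pow_N_mono σ hk)

/-- **The pieces `N^k H'` (`k ≤ e - 1`) of a string are `W_F`-irreducible.** [cite: TateCorvallis1979, (4.1.5)] -/
theorem isWIrreducible_map_pow_N (h : IsStringHead σ H' e) {k : ℕ} (hk : k ≤ e - 1) :
    IsWIrreducible σ (H'.map (σ.N ^ k)) := by
  have hinj : ∀ x ∈ H', (σ.N ^ k) x = 0 → x = 0 := fun x hx hx0 =>
    (Submodule.disjoint_def.mp (disjoint_head_ker h hk)) x hx (LinearMap.mem_ker.mpr hx0)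
  refine ⟨fun h0 => h.irreducible.1 ?_, h.irreducible.2.1.map_pow_N k, fun q hq hqst => ?_⟩
  · rw [eq_bot_iff]
    intro x hx
    have : (σ.N ^ k) x ∈ (⊥ : Submodule ℂ V) := h0 ▸ Submodule.mem_map_of_mem hx
    rw [Submodule.mem_bot] at this ⊢
    exact hinj x hx this
  · -- pull `q` back to the head
    set q' := q.comap (σ.N ^ k) ⊓ H' with hq'
    have hq'st : IsWStable σ q' := by
      intro w x hx
      rw [Submodule.mem_comap]
      refine Submodule.mem_inf.mpr ⟨?_, h.irreducible.2.1 w hx.2⟩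
      rw [Submodule.mem_comap, pow_N_ρ_apply]
      exact q.smul_mem _ (hqst w (Submodule.mem_comap.mp hx.1))
    rcases h.irreducible.2.2 q' inf_le_right hq'st with h0 | h1
    · left
      rw [eq_bot_iff]
      intro z hz
      obtain ⟨x, hx, rfl⟩ := hq hz
      have hx' : x ∈ q' := ⟨hz, hx⟩
      rw [h0, Submodule.mem_bot] at hx'
      rw [hx', map_zero]
      exact Submodule.zero_mem _
    · right
      refine le_antisymm hq ?_
      rintro _ ⟨x, hx, rfl⟩
      have : x ∈ q' := h1 ▸ hx
      exact this.1

/-- **`N^k : ρ_{H'} ⊗ ‖·‖^k ⥲ ρ_{N^k H'}`** (`k ≤ e - 1`): the twisted commutation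
`ρ(w) N^k = q^{k deg w} N^k ρ(w)` makes `N^k` an isomorphism of `W_F`-representations from the twisted
head onto the `k`-th piece. [cite: TateCorvallis1979, (4.1.5)] -/
theorem isoTw_head_piece (h : IsStringHead σ H' e) {k : ℕ} (hk : k ≤ e - 1) :
    IsoTw (σ.ρ.subrepresentation H' h.irreducible.2.1) (k : ℤ)
      (σ.ρ.subrepresentation (H'.map (σ.N ^ k)) (h.irreducible.2.1.map_pow_N k)) := by
  set f : H' →ₗ[ℂ] H'.map (σ.N ^ k) :=
    LinearMap.codRestrict (H'.map (σ.N ^ k)) ((σ.N ^ k) ∘ₗ H'.subtype)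
      (fun x => Submodule.mem_map_of_mem x.2) with hf
  have hfapply : ∀ x : H', (f x : V) = (σ.N ^ k) x := fun x => rfl
  have hinj : Function.Injective f := by
    intro x y hxy
    have h1 : (σ.N ^ k) (x - y : V) = 0 := by
      rw [map_sub, sub_eq_zero]; exact congrArg Subtype.val hxy
    have := (Submodule.disjoint_def.mp (disjoint_head_ker h hk)) _ (Submodule.sub_mem _ x.2 y.2)
      (LinearMap.mem_ker.mpr h1)
    exact Subtype.ext (sub_eq_zero.mp this)
  have hsurj : Function.Surjective f := by
    rintro ⟨_, x, hx, rfl⟩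
    exact ⟨⟨x, hx⟩, rfl⟩
  refine ⟨Representation.Equiv.mk (LinearEquiv.ofBijective f ⟨hinj, hsurj⟩) fun w => ?_⟩
  refine LinearMap.ext fun x => Subtype.ext ?_
  change ((f (twistRep (σ.ρ.subrepresentation H' h.irreducible.2.1) (k : ℤ) w x) : V)) =
    σ.ρ w (f x : V)
  rw [hfapply, hfapply, twistRep_apply, Submodule.coe_smul, map_smul, zpow_natCast,
    ρ_pow_N_apply]
  rfl

end Pieces

/-! ## The depth of a `W_F`-map into a string -/

section Depth

variable [FiniteDimensional ℂ H] {σ : WeilDeligneRep F ℂ V} {H' : Submodule ℂ V} {e : ℕ}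
  {ρ : Representation ℂ (WeilGroup F) H}

omit [FiniteDimensional ℂ H] in
/-- Twisted equivariance of `N^k ∘ g` for a `W_F`-equivariant `g`: it intertwines `ρ ⊗ ‖·‖^k`.
[cite: TateCorvallis1979, (4.1.2)] -/
theorem comp_pow_N_intertwines {g : H →ₗ[ℂ] V} (hgW : ∀ w, g ∘ₗ ρ w = σ.ρ w ∘ₗ g) (k : ℕ)
    (w : WeilGroup F) : ((σ.N ^ k) ∘ₗ g) ∘ₗ twistRep ρ (k : ℤ) w = σ.ρ w ∘ₗ ((σ.N ^ k) ∘ₗ g) := by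
  refine LinearMap.ext fun x => ?_
  simp only [LinearMap.coe_comp, Function.comp_apply, twistRep_apply, map_smul, zpow_natCast]
  rw [show g (ρ w x) = σ.ρ w (g x) from congr($(hgW w) x), pow_N_ρ_apply, smul_smul,
    mul_inv_cancel₀ (qpow_ne_zero w k), one_smul]

omit [FiniteDimensional ℂ H] in
/-- **Depth lemma.**  Let `g : (H, ρ) → (V, σ)` be a non-zero `W_F`-equivariant map with values in the
string `string(H', e)`, `ρ` irreducible.  If `m` is least with `N^m ∘ g = 0`, then `1 ≤ m ≤ e`,
`N^{m-1} ∘ g ≠ 0`, and `ρ ≅ ρ_{H'} ⊗ ‖·‖^{e-m}`: indeed `N^{m-1} ∘ g` is a non-zero `W_F`-map from the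
irreducible `ρ ⊗ ‖·‖^{m-1}` into the irreducible socle `N^{e-1} H' ≅ ρ_{H'} ⊗ ‖·‖^{e-1}`, hence an
isomorphism. [cite: HenniartBSMF2002, §4] -/
theorem depth_lemma (h : IsStringHead σ H' e) (hρ : ρ.IsIrreducible) {g : H →ₗ[ℂ] V}
    (hgW : ∀ w, g ∘ₗ ρ w = σ.ρ w ∘ₗ g) (hgS : ∀ x, g x ∈ stringSpan σ H' e) (hg0 : g ≠ 0) :
    ∃ m : ℕ, 1 ≤ m ∧ m ≤ e ∧ (σ.N ^ m) ∘ₗ g = 0 ∧ (σ.N ^ (m - 1)) ∘ₗ g ≠ 0 ∧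
      IsoTw (σ.ρ.subrepresentation H' h.irreducible.2.1) ((e : ℤ) - m) ρ := by
  classical
  have hex : ∃ k : ℕ, (σ.N ^ k) ∘ₗ g = 0 :=
    ⟨e, LinearMap.ext fun x => LinearMap.mem_ker.mp (stringSpan_le_ker h (hgS x))⟩
  set m := Nat.find hex with hm
  have hmspec : (σ.N ^ m) ∘ₗ g = 0 := Nat.find_spec hex
  have hme : m ≤ e := Nat.find_le (LinearMap.ext fun x => LinearMap.mem_ker.mp (stringSpan_le_ker h (hgS x)))
  have hm1 : 1 ≤ m := by
    rw [Nat.one_le_iff_ne_zero]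
    intro h0
    apply hg0
    have := hmspec
    rwa [h0, pow_zero, Module.End.one_eq_id, LinearMap.id_comp] at this
  have hmin : (σ.N ^ (m - 1)) ∘ₗ g ≠ 0 := Nat.find_min hex (by omega)
  refine ⟨m, hm1, hme, hmspec, hmin, ?_⟩
  -- `g₁ := N^{m-1} ∘ g : ρ ⊗ ‖·‖^{m-1} → socle`
  set g₁ := (σ.N ^ (m - 1)) ∘ₗ g with hg₁
  set L := H'.map (σ.N ^ (e - 1)) with hL
  have hLirr : IsWIrreducible σ L := isWIrreducible_map_pow_N h le_rfl
  have hg₁W : ∀ w, g₁ ∘ₗ twistRep ρ ((m - 1 : ℕ) : ℤ) w = σ.ρ w ∘ₗ g₁ :=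
    fun w => comp_pow_N_intertwines hgW (m - 1) w
  have hg₁L : ∀ x, g₁ x ∈ L := by
    intro x
    refine mem_socle_of_mem_stringSpan h (pow_N_mem_stringSpan h _ (hgS x)) ?_
    have : (σ.N ^ m) (g x) = 0 := congr($hmspec x)
    rw [← this, hg₁, LinearMap.comp_apply, ← Module.End.mul_apply, ← pow_succ',
      Nat.sub_add_cancel hm1]
  -- as an intertwining map into the socle it is bijective
  haveI := isIrreducible_twistRep hρ ((m - 1 : ℕ) : ℤ)
  haveI := hLirr.isIrreducible_subrepresentation
  set ρL := σ.ρ.subrepresentation L hLirr.2.1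
  let G₁ : (twistRep ρ ((m - 1 : ℕ) : ℤ)).IntertwiningMap ρL :=
    (LinearMap.codRestrict L g₁ hg₁L).intertwiningMap_of_isIntertwiningMap _ ρL fun w x =>
      Subtype.ext (congr($(hg₁W w) x))
  have hG₁ : G₁ ≠ 0 := by
    intro h0
    apply hmin
    refine LinearMap.ext fun x => ?_
    have h1 : ((G₁ x : L) : V) = 0 := by rw [h0]; rfl
    exact h1
  have hbij := (Representation.IsIrreducible.bijective_or_eq_zero G₁).resolve_right hG₁
  have hiso₁ : IsoTw ρ ((m - 1 : ℕ) : ℤ) ρL := ⟨G₁.ofBijective hbij⟩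
  have hiso₂ : IsoTw (σ.ρ.subrepresentation H' h.irreducible.2.1) ((e - 1 : ℕ) : ℤ) ρL :=
    isoTw_head_piece h le_rfl
  have := hiso₂.of_common hiso₁
  have heq : (((e - 1 : ℕ) : ℤ) - ((m - 1 : ℕ) : ℤ)) = (e : ℤ) - m := by
    rw [Nat.cast_sub hm1, Nat.cast_sub (Nat.one_le_iff_ne_zero.mpr h.pos.ne')]
    push_cast
    ring
  rwa [heq] at this

omit [FiniteDimensional ℂ H] in
/-- The depth is at most `d` when `N^d ∘ g = 0`. [folklore] -/
theorem depth_le_of_pow_comp_eq_zero {g : H →ₗ[ℂ] V} {m d : ℕ} (hmin : (σ.N ^ (m - 1)) ∘ₗ g ≠ 0)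
    (hd : (σ.N ^ d) ∘ₗ g = 0) : m ≤ d := by
  by_contra hlt
  apply hmin
  have hdm : d ≤ m - 1 := by omega
  rw [← Nat.sub_add_cancel hdm, pow_add, Module.End.mul_eq_comp, LinearMap.comp_assoc, hd,
    LinearMap.comp_zero]

end Depth

/-! ## The count -/

section Count

variable [FiniteDimensional ℂ V] [FiniteDimensional ℂ H] {σ : WeilDeligneRep F ℂ V}
  {H' : Submodule ℂ V} {e : ℕ} {ρ : Representation ℂ (WeilGroup F) H}

omit [FiniteDimensional ℂ V] [FiniteDimensional ℂ H] in
/-- **Lower bound**: if `ρ ≅ ρ_{H'} ⊗ ‖·‖^i` with `i < e ≤ d + i`, then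
`g := N^i ∘ (ρ_{H'} ⊗ ‖·‖^i ≅ ρ)⁻¹` is a non-zero element of the head space. [cite: HenniartBSMF2002, §4] -/
theorem exists_ne_zero_mem_headSpace (h : IsStringHead σ H' e) (hρ : ρ.IsIrreducible) {i d : ℕ} (hi : i < e)
    (hiso : IsoTw (σ.ρ.subrepresentation H' h.irreducible.2.1) (i : ℤ) ρ) (hd : e ≤ d + i) :
    ∃ g ∈ headSpace ρ σ d (stringSpan σ H' e), g ≠ 0 := by
  obtain ⟨eq⟩ := hiso
  set ι : H →ₗ[ℂ] V := H'.subtype ∘ₗ (eq.toLinearEquiv.symm : H →ₗ[ℂ] H') with hι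
  have hιmem : ∀ x, ι x ∈ H' := fun x => (eq.toLinearEquiv.symm x).2
  have hιW : ∀ w x, ι (ρ w x) = (((residueFieldCard F : ℂ) ^ (deg w)) ^ (i : ℤ)) • σ.ρ w (ι x) := by
    intro w x
    have h1 : eq.toLinearEquiv.symm (ρ w x) =
        twistRep (σ.ρ.subrepresentation H' h.irreducible.2.1) (i : ℤ) w (eq.toLinearEquiv.symm x) := by
      apply eq.toLinearEquiv.injective
      rw [LinearEquiv.apply_symm_apply]
      have h2 := eq.toIntertwiningMap.isIntertwining _ ρ w (eq.toLinearEquiv.symm x)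
      have h3 : eq (eq.toLinearEquiv.symm x) = x := eq.toLinearEquiv.apply_symm_apply x
      rw [Representation.Equiv.coe_toIntertwiningMap, h3] at h2
      exact h2.symm
    simp only [hι, LinearMap.coe_comp, Function.comp_apply, LinearEquiv.coe_coe, h1, twistRep_apply,
      Submodule.coe_subtype, Submodule.coe_smul]
    rfl
  refine ⟨(σ.N ^ i) ∘ₗ ι, ⟨fun w => ?_, ?_, fun x => ?_⟩, ?_⟩
  · refine LinearMap.ext fun x => ?_
    simp only [LinearMap.coe_comp, Function.comp_apply, hιW, map_smul, zpow_natCast, ρ_pow_N_apply]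
  · rw [← LinearMap.comp_assoc, ← Module.End.mul_eq_comp, ← pow_add]
    refine LinearMap.ext fun x => ?_
    have hx : ι x ∈ LinearMap.ker (σ.N ^ (d + i)) := ker_pow_N_mono σ hd (h.le_ker (hιmem x))
    simpa using hx
  · exact pow_N_apply_mem_stringSpan hi (hιmem x)
  · haveI := hρ
    obtain ⟨x, hx⟩ : ∃ x : H, x ≠ 0 := by
      by_contra hall
      have hall' : ∀ x : H, x = 0 := fun x => by_contra fun hx => hall ⟨x, hx⟩
      have hbt : (⊥ : Subrepresentation ρ) = ⊤ := by
        apply Subrepresentation.toSubmodule_injective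
        change (⊥ : Submodule ℂ H) = ⊤
        exact ((Submodule.eq_bot_iff ⊤).mpr fun y _ => hall' y).symm
      exact bot_ne_top hbt
    intro h0
    have h1 : (σ.N ^ i) (ι x) = 0 := congr($h0 x)
    have h2 : ι x = 0 := (Submodule.disjoint_def.mp (disjoint_head_ker h (by omega))) _ (hιmem x)
      (LinearMap.mem_ker.mpr h1)
    have h3 : eq.toLinearEquiv.symm x = 0 := by
      apply Subtype.ext
      simpa [hι] using h2
    exact hx (eq.toLinearEquiv.symm.injective (by rw [h3, map_zero]))

/-- **The count against a single string.**  `dim Hom_W(ρ, σ; N^d = 0, string(H', e))` is `1` when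
`ρ ≅ ρ_{H'} ⊗ ‖·‖^i` for some `i < e` with `e ≤ d + i`, and `0` otherwise. [cite: HenniartBSMF2002, §4] -/
theorem finrank_headSpace_stringSpan (h : IsStringHead σ H' e) (hρ : ρ.IsIrreducible) (d : ℕ) :
    ((∃ i : ℕ, i < e ∧ IsoTw (σ.ρ.subrepresentation H' h.irreducible.2.1) (i : ℤ) ρ ∧ e ≤ d + i) →
      finrank ℂ (headSpace ρ σ d (stringSpan σ H' e)) = 1) ∧
    ((¬ ∃ i : ℕ, i < e ∧ IsoTw (σ.ρ.subrepresentation H' h.irreducible.2.1) (i : ℤ) ρ ∧ e ≤ d + i) →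
      finrank ℂ (headSpace ρ σ d (stringSpan σ H' e)) = 0) := by
  haveI : Nontrivial H' := Submodule.nontrivial_iff_ne_bot.mpr h.irreducible.1
  set X := headSpace ρ σ d (stringSpan σ H' e) with hX
  -- every non-zero element has the depth dictated by the (unique) twist
  have depth : ∀ g ∈ X, g ≠ 0 → ∃ m : ℕ, 1 ≤ m ∧ m ≤ e ∧ m ≤ d ∧ (σ.N ^ m) ∘ₗ g = 0 ∧
      (σ.N ^ (m - 1)) ∘ₗ g ≠ 0 ∧ IsoTw (σ.ρ.subrepresentation H' h.irreducible.2.1) ((e : ℤ) - m) ρ := by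
    intro g hg hg0
    obtain ⟨m, hm1, hme, hm0, hmin, hiso⟩ := depth_lemma h hρ hg.1 hg.2.2 hg0
    exact ⟨m, hm1, hme, depth_le_of_pow_comp_eq_zero hmin hg.2.1, hm0, hmin, hiso⟩
  constructor
  · rintro ⟨i, hi, hiso, hdi⟩
    set m₀ := e - i with hm₀
    have hmg : ∀ g ∈ X, g ≠ 0 → (σ.N ^ m₀) ∘ₗ g = 0 ∧ (σ.N ^ (m₀ - 1)) ∘ₗ g ≠ 0 := by
      intro g hg hg0
      obtain ⟨m, hm1, hme, -, hm0, hmin, hiso'⟩ := depth g hg hg0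
      have heq : ((e : ℤ) - m) = (i : ℤ) := isoTw_unique hiso' hiso
      have : m = m₀ := by omega
      subst this
      exact ⟨hm0, hmin⟩
    apply le_antisymm
    · -- `≤ 1`: `g ↦ N^{m₀-1} ∘ g` is injective on `X` into a Schur space
      obtain ⟨g₀, hg₀X, hg₀0⟩ := exists_ne_zero_mem_headSpace h hρ hi hiso hdi
      have key : ∀ g ∈ X, ∃ c : ℂ, g = c • g₀ := by
        intro g hg
        set L := H'.map (σ.N ^ (e - 1))
        have hLirr : IsWIrreducible σ L := isWIrreducible_map_pow_N h le_rfl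
        have hval : ∀ f ∈ X, ∀ x, ((σ.N ^ (m₀ - 1)) ∘ₗ f) x ∈ L := by
          intro f hf x
          refine mem_socle_of_mem_stringSpan h (pow_N_mem_stringSpan h _ (hf.2.2 x)) ?_
          rw [LinearMap.comp_apply, ← Module.End.mul_apply, ← pow_succ', Nat.sub_add_cancel (by omega)]
          by_cases hf0 : f = 0
          · simp [hf0]
          · exact congr($((hmg f hf hf0).1) x)
        obtain ⟨c, hc⟩ := exists_smul_eq_of_intertwining (isIrreducible_twistRep hρ ((m₀ - 1 : ℕ) : ℤ))
          hLirr (comp_pow_N_intertwines hg₀X.1 (m₀ - 1)) (hval g₀ hg₀X)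
          (comp_pow_N_intertwines hg.1 (m₀ - 1)) (hval g hg) (hmg g₀ hg₀X hg₀0).2
        refine ⟨c, ?_⟩
        by_contra hne
        have h1 : (σ.N ^ (m₀ - 1)) ∘ₗ (g - c • g₀) = 0 := by
          rw [LinearMap.comp_sub, LinearMap.comp_smul, hc, sub_self]
        exact (hmg _ (X.sub_mem hg (X.smul_mem c hg₀X)) (sub_ne_zero.mpr hne)).2 h1
      have : finrank ℂ X ≤ 1 := by
        refine finrank_le_one ⟨g₀, hg₀X⟩ fun w => ?_
        obtain ⟨c, hc⟩ := key w.1 w.2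
        exact ⟨c, Subtype.ext (by simp [hc])⟩
      exact this
    · -- `≥ 1`
      rw [Nat.one_le_iff_ne_zero, Ne, Submodule.finrank_eq_zero]
      obtain ⟨g₀, hg₀X, hg₀0⟩ := exists_ne_zero_mem_headSpace h hρ hi hiso hdi
      intro hbot
      exact hg₀0 ((Submodule.mem_bot ℂ).mp (hbot ▸ hg₀X))
  · intro hno
    rw [Submodule.finrank_eq_zero, eq_bot_iff]
    intro g hg
    rw [Submodule.mem_bot]
    by_contra hg0
    obtain ⟨m, hm1, hme, hmd, -, -, hiso⟩ := depth g hg hg0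
    refine hno ⟨e - m, by omega, ?_, by omega⟩
    rwa [Nat.cast_sub hme]

end Count

/-- **Registered sub-goal `stub_finrank_headSpace_stringSpan`** (the `Hom`-count against a single string,
Henniart 2002, §4): `dim Hom_W(ρ, σ; N^d = 0, string(H', e)) = 1` iff `ρ ≅ ρ_{H'} ⊗ ‖·‖^i` for some
`i < e` with `e ≤ d + i`, else `0`. [cite: HenniartBSMF2002, §4] -/
theorem stub_finrank_headSpace_stringSpan : ∀ (F : Type) [Field F] [ValuativeRel F] [TopologicalSpace F] [IsNonarchimedeanLocalField F] (H : Type) [AddCommGroup H] [Module ℂ H] [FiniteDimensional ℂ H] (V : Type) [AddCommGroup V] [Module ℂ V] [FiniteDimensional ℂ V] (ρ : Representation ℂ (WeilGroup F) H) [ρ.IsIrreducible] (σ : WeilDeligneRep F ℂ V) (H' : Submodule ℂ V) (e : ℕ) (h : IsStringHead σ H' e) (d : ℕ), ((∃ i : ℕ, i < e ∧ IsoTw (σ.ρ.subrepresentation H' h.irreducible.2.1) (i : ℤ) ρ ∧ e ≤ d + i) → Module.finrank ℂ ↥(headSpace ρ σ d (stringSpan σ H' e)) = 1) ∧ ((¬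 ∃ i : ℕ, i < e ∧ IsoTw (σ.ρ.subrepresentation H' h.irreducible.2.1) (i : ℤ) ρ ∧ e ≤ d + i) → Module.finrank ℂ ↥(headSpace ρ σ d (stringSpan σ H' e)) = 0) :=
  fun _ _ _ _ _ _ _ _ _ _ _ _ _ _ hρ _ _ _ h d => finrank_headSpace_stringSpan h hρ d


end Summit.Langlands.Langlands.Theorems.ReciprocityUpToIrreducibilityR

end
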